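import Summits.HodgeConjecture.HodgeConjecture.Theorems.CYFormCasimirCYFormSquarePrincipleTestPoly
import Summits.HodgeConjecture.HodgeConjecture.Theorems.CYFormCasimirCYFormSquarePrincipleHodgeEndo
import HarnessLib

/-!
# Crux X3 `CYFormSquarePrinciple` (route `CYFormCasimir`, stmt-HodgeConjecture-23494), helper file 4c:
# (A1) the Calabi–Yau form `T ⊂ H⁴(A(ℂ); ℂ)` is stable under the Hodge group, hence under `SU_H(ℂ)`

research route conditional on HC_CM; not a corollary. Nothing here proves HC, HC_CM or any rung.

For an abelian eightfold `A` with `φ ≫ φ = -d` and a sub-`ℂ`-space `T ⊂ H⁴(A(ℂ); ℂ)` as in the crux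
(`T ≤ ⋀⁴W ⊕ ⋀⁴W^*`, `T ∩ ⋀⁴W = 0`, `dim T = 70`, spanned by rational classes and by pure-type classes — a
sub-Hodge structure of CY type, van Geemen–Rapagnetta arXiv:2607.18341 §1.15, Friedman–Laza Prop. 37):

* `exists_hodgeProjector` — there is a `ℂ`-linear `P : H⁴ → H⁴` with image EXACTLY `T` which maps rational
  classes to rational classes and preserves Hodge types: `P = π_T ∘ q((𝟙 + 2φ)^*)`, `π_T` the projection of
  `⋀⁴W ⊕ ⋀⁴W^* = T ⊕ (𝟙 + 2φ)^*T` onto `T` (helper files 4a, 4b; rationality by Galois descent `σ_*`,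
  Hodge types by the type projectors — both summands are `σ_*`- and type-stable);
* `hodgeGroup_apply_mem_cyForm` — **(A1)** every element of the Tannaka-free Hodge group `Hg(A)(ℂ)` maps
  `T` into itself (a Hodge-structure endomorphism commutes with `Hg`, helper file 1; Deligne LNM 900 I §3);
* `extAct_mem_cyForm_of_mem_weilSpecialUnitaryGroup` — under `HasHodgeGroupSU` (`Hg|_{H¹} = SU_H(ℂ)`,
  van Geemen 6.11/6.12) the exterior action `⋀⁴u` of every `u ∈ SU_H(ℂ)` maps `T` into itself.

References: Deligne1982HodgeCycles (I §3), vanGeemen1994HodgeAV (6.4–6.12), FriedmanLaza2013 (§3.5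
Prop. 37), vanGeemenRapagnetta2026WeilHK (§1.15).
-/

-- `Summit.HodgeConjecture.HodgeConjecture.…` is the tree's mandated summit/problem namespace (single-problem summit).
set_option linter.dupNamespace false
noncomputable section

open CategoryTheory
open Literature.AlgebraicTopology.SingularHomology
open Literature.AlgebraicGeometry.Motives
open Literature.AlgebraicGeometry.HodgeTheory
open Literature.AlgebraicGeometry.VanGeemen1994

namespace Summit.HodgeConjecture.HodgeConjecture.Theorems.CYFormSquare

section CYForm

variable {A : AbelianVariety ℂ} {d : ℕ} {φ : A ⟶ A}
variable (hn : 2 ≤ 4) (hd : 0 < d) (hA : A.dim = 2 * 4) (hφ : φ ≫ φ = -(d • 𝟙 A))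
  (e : ProjectiveEmbedding A.X) {a : complexBetti (projectiveSpace e.n ℂ) 2} (ha : IsRationalClass a)
  (ha0 : a ≠ 0)
  {T : Submodule ℂ (complexBetti A.X (2 * 2))}
  (hTle : T ≤ weilClassesPlus A φ 2 d ⊔ weilClassesMinus A φ 2 d)
  (hT0 : T ⊓ weilClassesPlus A φ 2 d = ⊥)
  (hT70 : Module.finrank ℂ T = 70)
  (hTrat : T ≤ Submodule.span ℂ {c | c ∈ T ∧ IsRationalClass c})
  (hThs : T ≤ Submodule.span ℂ {c | c ∈ T ∧ ∃ p q : ℕ, p + q = 4 ∧ IsOfHodgeType (2 * 4) A.X (2 * 2) p q c})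

include hd hTle hT0 hTrat in
/-- Uniqueness of the decomposition along `T ⊕ Ψ T` (`Ψ = (𝟙 + 2φ)^*`). [cite: FriedmanLaza2013, §3.5 Prop. 37] -/
theorem eq_of_add_eq_add_testOp {t₁ t₂ s₁ s₂ : complexBetti A.X (2 * 2)} (ht₁ : t₁ ∈ T) (ht₂ : t₂ ∈ T)
    (hs₁ : s₁ ∈ T.map (complexBetti.map ((1 : ℕ) • 𝟙 A + (2 : ℕ) • φ).hom.hom.hom (2 * 2)).hom)
    (hs₂ : s₂ ∈ T.map (complexBetti.map ((1 : ℕ) • 𝟙 A + (2 : ℕ) • φ).hom.hom.hom (2 * 2)).hom)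
    (h : t₁ + s₁ = t₂ + s₂) : t₁ = t₂ := by
  have hmem : t₁ - t₂ ∈ T ⊓ T.map (complexBetti.map ((1 : ℕ) • 𝟙 A + (2 : ℕ) • φ).hom.hom.hom (2 * 2)).hom := by
    refine ⟨T.sub_mem ht₁ ht₂, ?_⟩
    have e : t₁ - t₂ = s₂ - s₁ := by rw [sub_eq_sub_iff_add_eq_add, h, add_comm]
    rw [e]; exact Submodule.sub_mem _ hs₂ hs₁
  rw [inf_map_testOp_eq_bot hd hTle hT0 hTrat, Submodule.mem_bot, sub_eq_zero] at hmem
  exact hmem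

include hd hA hTle hT0 hTrat in
/-- **Rationality of the `T`-component**: if `w` is rational, `p ∈ T` and `w - p ∈ Ψ T`, then `p` is rational
(both summands are stable under the coefficient twists `σ_*`; Galois descent). [cite: Deligne1982HodgeCycles, I §3] -/
theorem isRationalClass_of_decomp {w p : complexBetti A.X (2 * 2)} (hw : IsRationalClass w) (hp : p ∈ T)
    (hs : w - p ∈ T.map (complexBetti.map ((1 : ℕ) • 𝟙 A + (2 : ℕ) • φ).hom.hom.hom (2 * 2)).hom) :
    IsRationalClass p := by
  have hX : IsSmoothProjective (2 * 4) A.X := isSmoothProjective_of_dim_eq' hA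
  refine isRationalClass_of_forall_coeffClass_eq hX fun σ ↦ ?_
  set τ := coeffClass (Y := ComplexPoints A.X) (R := ℂ) (S := ℂ) σ.toRingHom.toAddMonoidHom (2 * 2) with hτ
  have h1 : τ p ∈ T := coeffClass_mem_of_mem hTrat σ hp
  have h2 : τ (w - p) ∈ T.map (complexBetti.map ((1 : ℕ) • 𝟙 A + (2 : ℕ) • φ).hom.hom.hom (2 * 2)).hom := by
    obtain ⟨t, ht, hts⟩ := Submodule.mem_map.1 hs
    rw [← hts]
    refine Submodule.mem_map.2 ⟨τ t, coeffClass_mem_of_mem hTrat σ ht, ?_⟩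
    exact (coeffClass_map (R := ℂ) (S := ℂ) σ.toRingHom.toAddMonoidHom
      (Literature.AlgebraicGeometry.Motives.AlgPoints.mapContinuous (L := ℂ) ((1 : ℕ) • 𝟙 A + (2 : ℕ) • φ).hom.hom.hom)
      t).symm
  refine eq_of_add_eq_add_testOp hd hTle hT0 hTrat h1 hp h2 hs ?_
  rw [← map_add, add_sub_cancel]
  exact hw.coeffClass_ringHom_eq σ.toRingHom

include hd hA hTle hT0 hTrat hThs in
/-- **Hodge type of the `T`-component**: if `w` is of type `(p', q')`, `p ∈ T` and `w - p ∈ Ψ T`, then `p` is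
of type `(p', q')` (both summands are stable under the type projectors, which commute with `Ψ`).
[cite: VoisinHodgeI2002, §7.1.1 and §7.3.2] -/
theorem isOfHodgeType_of_decomp {w p : complexBetti A.X (2 * 2)} {p' q' : ℕ}
    (hw : IsOfHodgeType (2 * 4) A.X (2 * 2) p' q' w) (hp : p ∈ T)
    (hs : w - p ∈ T.map (complexBetti.map ((1 : ℕ) • 𝟙 A + (2 : ℕ) • φ).hom.hom.hom (2 * 2)).hom) :
    IsOfHodgeType (2 * 4) A.X (2 * 2) p' q' p := by
  classical
  have hX : IsSmoothProjective (2 * 4) A.X := isSmoothProjective_of_dim_eq' hA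
  obtain ⟨M⟩ := nonempty_hodgeModel_holds hX
  by_cases hpq : p' + q' = 2 * 2
  · set pq₀ : ↥(Finset.HasAntidiagonal.antidiagonal (2 * 2)) :=
      ⟨(p', q'), Finset.HasAntidiagonal.mem_antidiagonal.2 hpq⟩ with hpq₀
    have hw' : w ∈ M.typePiece (2 * 2) pq₀ := (M.mem_typePiece_iff_isOfHodgeType' hX pq₀ w).2 hw
    -- all other type components of `p` vanish
    have hzero : ∀ pq, pq ≠ pq₀ → M.typeProj (2 * 2) pq p = 0 := by
      intro pq hne
      have hw0 : M.typeProj (2 * 2) pq w = 0 := M.typeProj_apply_of_mem_ne (Ne.symm hne) hw'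
      have h1 : M.typeProj (2 * 2) pq p ∈ T := typeProj_mem_of_mem hA M hThs pq hp
      have h2 : M.typeProj (2 * 2) pq (w - p) ∈
          T.map (complexBetti.map ((1 : ℕ) • 𝟙 A + (2 : ℕ) • φ).hom.hom.hom (2 * 2)).hom := by
        obtain ⟨t, ht, hts⟩ := Submodule.mem_map.1 hs
        rw [← hts]
        refine Submodule.mem_map.2 ⟨M.typeProj (2 * 2) pq t, typeProj_mem_of_mem hA M hThs pq ht, ?_⟩
        exact HodgeModel.map_typeProj_eq M hX hX _ M pq t
      refine eq_of_add_eq_add_testOp hd hTle hT0 hTrat h1 T.zero_mem h2 (Submodule.zero_mem _) ?_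
      rw [← map_add, add_sub_cancel, hw0, add_zero]
    have hsum : p = M.typeProj (2 * 2) pq₀ p := by
      conv_lhs => rw [← M.sum_typeProj (2 * 2) p]
      rw [Finset.sum_eq_single pq₀ (fun pq _ hne ↦ hzero pq hne) (fun h ↦ absurd (Finset.mem_univ _) h)]
    rw [hsum]
    exact (M.mem_typePiece_iff_isOfHodgeType' hX pq₀ _).1 (M.typeProj_mem _ pq₀ p)
  · have hw0 : w = 0 := hw.eq_zero_of_add_ne hpq
    have hp0 : p = 0 := by
      refine eq_of_add_eq_add_testOp hd hTle hT0 hTrat hp T.zero_mem hs (Submodule.zero_mem _) ?_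
      rw [add_sub_cancel, hw0, add_zero]
    rw [hp0]
    exact IsOfHodgeType.zero M _ _ _

include hn hd hA hφ e ha ha0 hTle hT0 hT70 hTrat hThs in
/-- **The Hodge projector onto the CY form.** There is a `ℂ`-linear endomorphism `P` of `H⁴(A(ℂ); ℂ)` with
image exactly `T` which maps rational classes to rational classes and preserves Hodge types:
`P = π_T ∘ q((𝟙 + 2φ)^*)`, `π_T` the projection of `⋀⁴W ⊕ ⋀⁴W^* = T ⊕ (𝟙 + 2φ)^* T` onto `T`.
[cite: Deligne1982HodgeCycles, I §3] [cite: FriedmanLaza2013, §3.5 Prop. 37] -/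
theorem exists_hodgeProjector :
    ∃ P : complexBetti A.X (2 * 2) →ₗ[ℂ] complexBetti A.X (2 * 2),
      (∀ v, IsRationalClass v → IsRationalClass (P v)) ∧
      (∀ (p q : ℕ) (v : complexBetti A.X (2 * 2)),
        IsOfHodgeType (2 * 4) A.X (2 * 2) p q v → IsOfHodgeType (2 * 4) A.X (2 * 2) p q (P v)) ∧
      (∀ v, P v ∈ T) ∧ (∀ t ∈ T, ∃ v, P v = t) := by
  classical
  have hX : IsSmoothProjective (2 * 4) A.X := isSmoothProjective_of_dim_eq' hA
  obtain ⟨M⟩ := nonempty_hodgeModel_holds hX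
  set Ψ := (complexBetti.map ((1 : ℕ) • 𝟙 A + (2 : ℕ) • φ).hom.hom.hom (2 * 2)).hom with hΨ
  set Q : complexBetti A.X (2 * 2) →ₗ[ℂ] complexBetti A.X (2 * 2) :=
    (Ψ - ((1 + 4 * (d : ℂ)) ^ 2) • LinearMap.id) ∘ₗ
      (Ψ ∘ₗ Ψ - (2 * (1 + 4 * (d : ℂ)) * (1 - 4 * (d : ℂ))) • Ψ + ((1 + 4 * (d : ℂ)) ^ 4) • LinearMap.id) with hQ
  set T' := T.map Ψ with hT'
  set R := weilClassesPlus A φ 2 d ⊔ weilClassesMinus A φ 2 d with hR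
  have hRTT' : T ⊔ T' = R := sup_map_testOp_eq hn hd hA hφ e ha ha0 hTle hT0 hT70 hTrat
  have hTT' : T ⊓ T' = ⊥ := inf_map_testOp_eq_bot hd hTle hT0 hTrat
  obtain ⟨K, hK⟩ := Submodule.exists_isCompl R
  -- `T ⊕ (T' ⊕ K) = H⁴`
  have hc : IsCompl T (T' ⊔ K) := by
    refine ⟨?_, ?_⟩
    · rw [Submodule.disjoint_def]
      intro x hxT hx
      obtain ⟨s, hs, k, hk, hsk⟩ := Submodule.mem_sup.1 hx
      have hkR : k ∈ R := by
        have e1 : k = x - s := by rw [← hsk]; abel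
        rw [e1, ← hRTT']
        exact Submodule.sub_mem _ (Submodule.mem_sup_left hxT) (Submodule.mem_sup_right hs)
      have hk0 : k = 0 := by
        have := hK.1; rw [Submodule.disjoint_def] at this; exact this k hkR hk
      rw [hk0, add_zero] at hsk
      have : x ∈ T ⊓ T' := ⟨hxT, hsk ▸ hs⟩
      rwa [hTT', Submodule.mem_bot] at this
    · rw [codisjoint_iff, ← sup_assoc, hRTT']
      exact hK.2.eq_top
  set P : complexBetti A.X (2 * 2) →ₗ[ℂ] complexBetti A.X (2 * 2) := (T.projection (T' ⊔ K) hc) ∘ₗ Q with hP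
  have hPT : ∀ v, P v ∈ T := fun v ↦ Submodule.projection_apply_mem hc _
  have hQR : ∀ v, Q v ∈ R := fun v ↦ testPolyOp_mem_sup hn hd hA hφ e ha ha0 Q hQ v
  -- the `T'`-component
  have hPT' : ∀ v, Q v - P v ∈ T' := by
    intro v
    have h1 : Q v - P v ∈ T' ⊔ K := Submodule.sub_projection_mem hc (Q v)
    obtain ⟨s, hs, k, hk, hsk⟩ := Submodule.mem_sup.1 h1
    have hkR : k ∈ R := by
      have e1 : k = (Q v - P v) - s := by rw [← hsk]; abel
      rw [e1]
      refine Submodule.sub_mem _ (Submodule.sub_mem _ (hQR v) ?_) (hRTT' ▸ Submodule.mem_sup_right hs)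
      rw [← hRTT']; exact Submodule.mem_sup_left (hPT v)
    have hk0 : k = 0 := by
      have := hK.1; rw [Submodule.disjoint_def] at this; exact this k hkR hk
    rw [hk0, add_zero] at hsk
    rw [← hsk]; exact hs
  refine ⟨P, fun v hv ↦ ?_, fun p q v hv ↦ ?_, hPT, fun t ht ↦ ?_⟩
  · -- rationality
    exact isRationalClass_of_decomp hd hA hTle hT0 hTrat (isRationalClass_testPolyOp Q hQ hv) (hPT v) (hPT' v)
  · -- Hodge types
    refine isOfHodgeType_of_decomp hd hA hTle hT0 hTrat hThs (w := Q v) ?_ (hPT v) (hPT' v)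
    by_cases hpq : p + q = 2 * 2
    · set pq₀ : ↥(Finset.HasAntidiagonal.antidiagonal (2 * 2)) :=
        ⟨(p, q), Finset.HasAntidiagonal.mem_antidiagonal.2 hpq⟩ with hpq₀
      exact (M.mem_typePiece_iff_isOfHodgeType' hX pq₀ _).1
        (testPolyOp_mem_typePiece hA Q hQ M pq₀ ((M.mem_typePiece_iff_isOfHodgeType' hX pq₀ v).2 hv))
    · rw [hv.eq_zero_of_add_ne hpq, map_zero]
      exact IsOfHodgeType.zero M _ _ _
  · -- `T ≤ range P`
    have htR : t ∈ R := by rw [← hRTT']; exact Submodule.mem_sup_left ht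
    obtain ⟨v, hv⟩ := exists_testPolyOp_eq_of_mem_sup Q hQ hd htR
    refine ⟨v, ?_⟩
    rw [hP, LinearMap.comp_apply, hv]
    exact Submodule.projection_apply_of_mem_left hc ht

include hn hd hA hφ e ha ha0 hTle hT0 hT70 hTrat hThs in
/-- **(A1) The CY form is stable under the Hodge group**: for `g ∈ Hg(A)(ℂ)` (the tree's Tannaka-free
`hodgeGroup A.dim A.X`) and `t ∈ T`, `g₄ t ∈ T` — `T` is the image of the rational Hodge-type-preserving
endomorphism `P` of `H⁴`, with which `g` commutes (`hodgeGroup_apply_hodgeEndo`). [cite: Deligne1982HodgeCycles, I §3 Prop. 3.4]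
[cite: vanGeemenRapagnetta2026WeilHK, §1.15] -/
theorem hodgeGroup_apply_mem_cyForm {g : ∀ k : ℕ, complexBetti A.X k ≃ₗ[ℂ] complexBetti A.X k}
    (hg : g ∈ hodgeGroup A.dim A.X) {t : complexBetti A.X (2 * 2)} (ht : t ∈ T) : g (2 * 2) t ∈ T := by
  have hX : IsSmoothProjective (2 * 4) A.X := isSmoothProjective_of_dim_eq' hA
  rw [hA] at hg
  obtain ⟨P, hPr, hPt, hPT, hsurj⟩ := exists_hodgeProjector hn hd hA hφ e ha ha0 hTle hT0 hT70 hTrat hThs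
  obtain ⟨v, rfl⟩ := hsurj t ht
  rw [hodgeGroup_apply_hodgeEndo hX hg (2 * 2) P hPr hPt v]
  exact hPT _

include hn hd hA hφ e ha ha0 hTle hT0 hT70 hTrat hThs in
/-- **Under `HasHodgeGroupSU`, `⋀⁴u` maps the CY form into itself for every `u ∈ SU_H(ℂ)`** (`u = g₁` for some
`g ∈ Hg(A)(ℂ)`, and `g₄ = ⋀⁴g₁`, the tree's `hodgeGroup_apply_eq_extAct`). [cite: vanGeemen1994HodgeAV, 6.5 and Thm. 6.11–6.12] -/
theorem extAct_mem_cyForm_of_mem_weilSpecialUnitaryGroup {n' d' : ℕ} {h : complexBetti A.X 2}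
    (hSU : HasHodgeGroupSU A φ n' d' h) {u : complexBetti A.X 1 ≃ₗ[ℂ] complexBetti A.X 1}
    (hu : u ∈ weilSpecialUnitaryGroup A φ n' d' h) {t : complexBetti A.X (2 * 2)} (ht : t ∈ T) :
    extAct (u : complexBetti A.X 1 →ₗ[ℂ] complexBetti A.X 1) (2 * 2) t ∈ T := by
  have hu' : u ∈ hodgeGroupOne A.dim A.X := by rw [hSU]; exact hu
  obtain ⟨g, hg, rfl⟩ := mem_hodgeGroupOne_iff.1 hu'
  rw [← hodgeGroup_apply_eq_extAct hg (2 * 2) t]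
  exact hodgeGroup_apply_mem_cyForm hn hd hA hφ e ha ha0 hTle hT0 hT70 hTrat hThs hg ht

end CYForm

end Summit.HodgeConjecture.HodgeConjecture.Theorems.CYFormSquare

end
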